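import Mathlib
import Summits.NavierStokesRegularity.NavierStokesRegularity.Theorems.TaoLadderRungTwoBreakOneShiftWindowRoughStepD
import HarnessLib

/-!
# The one-shift window system, XXXVII: THE END-OF-STEP BOX — the tight Taylor enclosure `z(t) ∈ Σ_{j<K} t^j Φ_j(W) +
# t^K Φ_K(S)` of every centre solution at a time `t` of the step, read from the jets the centre test already
# computed, and its widening by `Ẑ₁` for the rough realisations: the containment the step CHAIN checks against the
# next step's start box (cell harvest/h2-tao-ladder, seat p2; rung1/KERNEL-CHEAP-REPLAY-SPEC.md §2 (f)/(h), §8;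
# support for K1(1) = `NoSurvivingDSSOne`, stmt-NavierStokesRegularity-20205)

MODEL lattice ODEs only (Tao 2016 §4 normal form on Tao's shift set `S`); nothing here is a statement about
the Navier–Stokes equations; no item is closed; no instance is evaluated here. Generic in `ι`, `κ`.

* `CentreStepD.endBox tD c` — `Σ_{j<K} tD^j ⊗ Φ_j(W)_c ⊕ tD^K ⊗ Φ_K(S)_c` for a point time `tD` (dyadic);
  **`CentreStepD.end_mem`**: `check = true`, `y₀ ∈ W`, `z` a solution of the centre field from `y₀` on `[0, h]`,
  `t = tD ∈ [0, h]` ⇒ `z t i ∈ endBox tD (e i)` (Literature `highOrderEnclosure_step_smooth`, second conclusion);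
* `RoughStepD.endBoxR tD c` — the same widened by `± Ẑ₁_c`; **`RoughStepD.end_mem`**: every rough realisation's
  run from `a ∈ W` satisfies `Su t i ∈ endBoxR tD (e i)`.
-/

-- the sub-problem namespace repeats the summit name by design (D-0017)
set_option linter.dupNamespace false

namespace Summit.NavierStokesRegularity.NavierStokesRegularity.Theorems

namespace DSSOneShift

open Set Finset Metric Filter Topology TopologicalSpace
open Literature.Analysis.ODE
open Summit.NavierStokesRegularity.NavierStokesRegularity.Theorems.TaylorModelCert
open Summit.NavierStokesRegularity.NavierStokesRegularity.Theorems.TaylorModelReadout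
open Summit.NavierStokesRegularity.NavierStokesRegularity.Theorems.CertificateGlueOn
open scoped ContDiff

namespace CentreStepD

variable (d : CentreStepD)

/-- **The end-of-step box at the point time `tD`**: `Σ_{j<K} tD^j ⊗ Φ_j(W)_c ⊕ tD^K ⊗ Φ_K(S)_c` from the jet tables of
the centre test. [cite: Moore1979, §8.1 eq. (8.10) (at t = t₁); NedialkovJacksonPryce2001, §3] -/
def endBox (tD : Dyad) (c : ℕ) : IntervalD :=
  IntervalD.addR d.prec
    (IntervalD.rangeSumR d.prec (fun j => IntervalD.mulR d.prec (IntervalD.powR d.prec (IntervalD.ofDyad tD) j)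
      (IntervalD.aget (IntervalD.lget (d.jets d.W) j) c)) d.K)
    (IntervalD.mulR d.prec (IntervalD.powR d.prec (IntervalD.ofDyad tD) d.K) (IntervalD.aget (IntervalD.lget (d.jets d.S) d.K) c))

variable {ι : Type*} [Fintype ι] [DecidableEq ι] {κ : Type*} [Fintype κ]

/-- **EVERY CENTRE SOLUTION ENDS IN THE END BOX.** [cite: Moore1979, §8.1 eq. (8.10); NedialkovJacksonPryce2001, §3] -/
theorem end_mem (T : κ → BTerm ι) (e : ι ≃ Fin d.n) (hSD : IsSQEnclosure (homQ T e) d.SD) (hc : d.check = true)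
    {y₀ : ι → ℝ} (hy₀ : y₀ ∈ boxSet (boxOf e d.W)) {z : ℝ → ι → ℝ} (hz0 : z 0 = y₀)
    (hz : ∀ t ∈ Icc 0 d.hD.toReal, HasDerivWithinAt z (termField T (z t)) (Icc 0 d.hD.toReal) t)
    {tD : Dyad} (ht : tD.toReal ∈ Icc 0 d.hD.toReal) (i : ι) :
    IntervalD.mem (z tD.toReal i) (d.endBox tD (e i)) := by
  classical
  rw [check_eq] at hc
  obtain ⟨hK, hh, hcS, -⟩ := d.of_checkWith hc
  have hwfW : ∀ c < d.n, wfD (IntervalD.aget d.W c) = true := fun c hc => (hcS c hc).1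
  have hwfS : ∀ c < d.n, wfD (IntervalD.aget d.S c) = true := fun c hc => wfD_of_wfsD (hcS c hc).2.1
  have hf : ContDiff ℝ ∞ (termField T) := (contDiff_termField T).of_le le_top
  have hfOn : ContDiffOn ℝ ∞ (termField T) ((⊤ : Opens (ι → ℝ)) : Set (ι → ℝ)) := termField_contDiffOn T
  have ePhi : ∀ j, smoothTaylorMap (Ω := ⊤) hfOn j = tjet T j := fun j => rfl
  -- jets (as in `sound`)
  have hjetW : ∀ x ∈ boxSet (boxOf e d.W), ∀ j ≤ d.K, ∀ i,
      IntervalD.mem (tjet T j x i) (IntervalD.aget (IntervalD.lget (d.jets d.W) j) (e i)) := by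
    intro x hx j hj i
    have hm : IntervalD.mem (tjet T j x (e.symm ⟨(e i : ℕ), (e i).isLt⟩)) (IntervalD.aget (IntervalD.lget (d.jets d.W) j) (e i)) :=
      mem_tjet_of_jetLevelsA T e hSD d.prec d.K (d.size_ext d.W) (d.hboxMem_of_mem_boxOf e hwfW hx) hj (e i).isLt
    simpa using hm
  have hjetS : ∀ x ∈ boxSet (boxOf e d.S), ∀ j ≤ d.K, ∀ i,
      IntervalD.mem (tjet T j x i) (IntervalD.aget (IntervalD.lget (d.jets d.S) j) (e i)) := by
    intro x hx j hj i
    have hm : IntervalD.mem (tjet T j x (e.symm ⟨(e i : ℕ), (e i).isLt⟩)) (IntervalD.aget (IntervalD.lget (d.jets d.S) j) (e i)) :=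
      mem_tjet_of_jetLevelsA T e hSD d.prec d.K (d.size_ext d.S) (d.hboxMem_of_mem_boxOf e hwfS hx) hj (e i).isLt
    simpa using hm
  -- the C⁰ theorem with the same boxes as `sound`
  set c : ι → ℝ := fun i => (IntervalD.aget (IntervalD.lget (d.jets d.S) d.K) (e i)).lo.toReal with hcdef
  set dd : ι → ℝ := fun i => (IntervalD.aget (IntervalD.lget (d.jets d.S) d.K) (e i)).hi.toReal with hdddef
  have hKS : MapsTo (smoothTaylorMap (Ω := ⊤) hfOn d.K) (boxSet (boxOf e d.S)) (Icc c dd) := by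
    intro x hx; rw [ePhi]
    exact ⟨fun i => (hjetS x hx d.K le_rfl i).1, fun i => (hjetS x hx d.K le_rfl i).2⟩
  have hcd : c ≤ dd := by
    have hz := hKS (left_mem_Icc.2 (boxLo_le_boxHi (boxOf e d.S)))
    exact fun i => (hz.1 i).trans (hz.2 i)
  have hincl : ∀ y ∈ boxSet (boxOf e d.W), ∀ t ∈ Icc 0 d.hD.toReal, ∀ v ∈ Icc c dd,
      (∑ j ∈ Finset.range d.K, t ^ j • smoothTaylorMap (Ω := ⊤) hfOn j y) + t ^ d.K • v ∈ boxSet (boxOf e d.S) := by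
    intro y hy t ht' v hv
    rw [mem_boxSet_iff]
    intro i
    refine mem_toNI (IntervalD.mem_of_subset (hcS (e i) (e i).isLt).2.2 ?_)
    simp only [Pi.add_apply, Finset.sum_apply, Pi.smul_apply, smul_eq_mul, ePhi]
    refine IntervalD.mem_addR d.prec (IntervalD.mem_rangeSumR d.prec d.K fun j hj => ?_) ?_
    · exact IntervalD.mem_mulR d.prec (d.mem_pows ht' (le_of_lt hj)) (hjetW y hy j (le_of_lt hj) i)
    · exact IntervalD.mem_mulR d.prec (d.mem_pows ht' le_rfl) ⟨hv.1 i, hv.2 i⟩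
  have H := highOrderEnclosure_step_smooth hf hK (S := boxSet (boxOf e d.S)) (W := boxSet (boxOf e d.W))
    (isBounded_boxSet _) (convex_boxSet _) hcd hKS hh hincl hy₀
  obtain ⟨-, v, hv, hzt⟩ := H.2 z hz0 hz tD.toReal ht
  have hzi := congrFun hzt i
  simp only [Pi.add_apply, Finset.sum_apply, Pi.smul_apply, smul_eq_mul, ePhi] at hzi
  rw [hzi]
  unfold endBox
  refine IntervalD.mem_addR d.prec (IntervalD.mem_rangeSumR d.prec d.K fun j hj => ?_) ?_
  · exact IntervalD.mem_mulR d.prec (IntervalD.mem_powR d.prec (IntervalD.mem_ofDyad tD) j) (hjetW y₀ hy₀ j (le_of_lt hj) i)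
  · exact IntervalD.mem_mulR d.prec (IntervalD.mem_powR d.prec (IntervalD.mem_ofDyad tD) d.K) ⟨hv.1 i, hv.2 i⟩

end CentreStepD

namespace RoughStepD

variable (d : RoughStepD)

/-- **The rough end-of-step box**: the centre end box widened by `± Ẑ₁`. [cite: KapelaZgliczynski2009, §4 Lemma 4.1; cell vocabulary, harvest/h2-tao-ladder rung1/KERNEL-CHEAP-REPLAY-SPEC.md §2 (f) (D_{s+1})] -/
def endBoxR (tD : Dyad) (c : ℕ) : IntervalD :=
  ⟨(d.centre.endBox tD c).lo.sub (dget d.Zh c), (d.centre.endBox tD c).hi.add (dget d.Zh c)⟩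

variable {ι : Type*} [Fintype ι] [DecidableEq ι] {κ : Type*} [Fintype κ]

/-- **EVERY ROUGH REALISATION'S RUN ENDS IN THE ROUGH END BOX.** [cite: KapelaZgliczynski2009, §4 Lemma 4.1; Moore1979, §8.1 eq. (8.10)] -/
theorem end_mem (e : ι ≃ Fin d.n) {Tc : κ → BTerm ι} {Tf : ℝ → κ → BTerm ι} {rows : ι → List κ}
    (hRDc : IsRTEncl e Tc Tc rows d.RD) (hRD : ∀ t ∈ Ico 0 d.hD.toReal, IsRTEncl e Tc (Tf t) rows d.RD)
    (hc : d.check = true) {a : ι → ℝ} (ha : a ∈ boxSet (boxOf e d.W)) {Su : ℝ → ι → ℝ} (hSu0 : Su 0 = a)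
    (hSu : ∀ t ∈ Icc 0 d.hD.toReal, HasDerivWithinAt Su (termField (Tf t) (Su t)) (Icc 0 d.hD.toReal) t)
    {tD : Dyad} (ht : tD.toReal ∈ Icc 0 d.hD.toReal) (i : ι) :
    IntervalD.mem (Su tD.toReal i) (d.endBoxR tD (e i)) := by
  have hc' : d.centre.check = true ∧ d.checkKZ = true := by simpa [check, Bool.and_eq_true] using hc
  obtain ⟨uc, hu, -, -, -, hrough⟩ := d.sound e hRDc hRD hc
  have hdev := (hrough a ha Su hSu0 hSu tD.toReal ht).2 i
  have hcen : IntervalD.mem (uc a tD.toReal i) (d.centre.endBox tD (e i)) :=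
    d.centre.end_mem Tc e (isSQEnclosure_sqC e hRDc d.prec) hc'.1 ha (hu.init a ha) (hu.hasDerivWithinAt a ha) ht i
  have h1 := abs_le.1 hdev
  unfold endBoxR
  simp only [IntervalD.mem, Dyad.toReal_sub, Dyad.toReal_add]
  constructor <;> linarith [hcen.1, hcen.2]

end RoughStepD

end DSSOneShift

end Summit.NavierStokesRegularity.NavierStokesRegularity.Theorems
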